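import Literature.NumberTheory.EllipticCurves.ShintaniKernelTransport
import HarnessLib

/-!
# Transport of the Shintani kernel terms under real matrices of determinant one; conjugation to `λ XY`

[[cite: Shintani1975, §2 (2.12), proof of Prop. 2.3 (p. 104: "There exists a `g₁ ∈ G` which
satisfies `ρ(g₁) x = √d_x (0, 1, 0)`")]] — we PROVE the transformation law of the kernel terms
under an arbitrary real `g = (a b; c d)` with `ad - bc = 1` acting on `ℍ` (as the element `glOf`
of `GL₂(ℝ)⁺`), and the existence of such a `g` moving an indefinite form to `λ XY`:

* `glOf`, `coe_glOf_smul` (`g • w = (aw+b)/(cw+d)`), `pw_glOf`, `majorant_glOf`, `formEval_glOf`,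
  **`shintaniFn_glOf`** — `f_{w,Z}(x ∘ g) = (cw + d)² f_{gw,Z}(x)` (the real-parameter core of
  `ShintaniKernelLevel64.shintaniFn_sl_smul`);
* **`exists_conj_to_xyForm`** — for `disc x > 0` there are real `a b c d`, `ad - bc = 1`, and
  `λ ≠ 0` with `x ∘ g = λ XY` (the columns of `g` point to the two roots; `λ² = disc x`).

No named facts; the only definition is `glOf`.
-/

noncomputable section

open scoped MatrixGroups ModularForm Modular Topology
open UpperHalfPlane hiding I
open Complex Filter MeasureTheory Set CongruenceSubgroup ModularGroup Real
open Literature.NumberTheory.EllipticCurves.ModularForms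

namespace Literature.NumberTheory.EllipticCurves.Shintani

/-! ### Real matrices of determinant one as elements of `GL₂(ℝ)` -/

/-- The matrix `(a b; c d)` with `ad - bc = 1` as an element of `GL₂(ℝ)`. [folklore] -/
def glOf (a b c d : ℝ) (hdet : a * d - b * c = 1) : GL (Fin 2) ℝ :=
  Matrix.GeneralLinearGroup.mkOfDetNeZero !![a, b; c, d] (by rw [Matrix.det_fin_two_of]; linarith)

/-- Its determinant is `1 > 0`. [folklore] -/
theorem det_glOf_pos {a b c d : ℝ} (hdet : a * d - b * c = 1) :
    0 < ((Matrix.GeneralLinearGroup.det (glOf a b c d hdet) : ℝˣ) : ℝ) := by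
  rw [Matrix.GeneralLinearGroup.val_det_apply]
  show 0 < Matrix.det !![a, b; c, d]
  rw [Matrix.det_fin_two_of]; linarith

/-- The denominator does not vanish on `ℍ`. [folklore] -/
theorem moeb_denom_ne_zero {a b c d : ℝ} (hdet : a * d - b * c = 1) (w : ℍ) : (c : ℂ) * w + d ≠ 0 := by
  have h := UpperHalfPlane.denom_ne_zero (glOf a b c d hdet) w
  rw [UpperHalfPlane.denom] at h
  simpa [glOf, Matrix.GeneralLinearGroup.mkOfDetNeZero] using h

/-- The action: `(a b; c d) • w = (a w + b)/(c w + d)`. [folklore] -/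
theorem coe_glOf_smul {a b c d : ℝ} (hdet : a * d - b * c = 1) (w : ℍ) :
    (((glOf a b c d hdet) • w : ℍ) : ℂ) = ((a : ℂ) * w + b) / ((c : ℂ) * w + d) := by
  rw [UpperHalfPlane.coe_smul_of_det_pos (det_glOf_pos hdet)]
  simp [glOf, UpperHalfPlane.num, UpperHalfPlane.denom, Matrix.GeneralLinearGroup.mkOfDetNeZero]

/-! ### The transformation laws -/

/-- `p_{g w}(x) = p_w(x ∘ g)` for real `g` of determinant one. [folklore] -/
theorem pw_glOf {a b c d : ℝ} (hdet : a * d - b * c = 1) (w : ℍ) (x : V) :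
    pw ((glOf a b c d hdet) • w) x = pw w (actV a b c d x) := by
  have hden : (c : ℂ) * (w : ℂ) + d ≠ 0 := moeb_denom_ne_zero hdet w
  have hre : ((glOf a b c d hdet) • w).re = ((((glOf a b c d hdet) • w : ℍ) : ℂ)).re := rfl
  have him : ((glOf a b c d hdet) • w).im = ((((glOf a b c d hdet) • w : ℍ) : ℂ)).im := rfl
  have hwre : w.re = (w : ℂ).re := rfl
  have hwim : w.im = (w : ℂ).im := rfl
  rw [pw, pw, hre, him, coe_glOf_smul hdet w, hwre, hwim]
  have key := normSq_mul_polar_moebius a b c d x hden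
  have key2 := normSq_mul_im_moebius a b c d hden
  rw [hdet, one_mul] at key2
  rw [polar_actV] at key
  set W : ℂ := ((a : ℂ) * (w : ℂ) + b) / ((c : ℂ) * (w : ℂ) + d) with hW
  set Nd : ℝ := Complex.normSq ((c : ℂ) * (w : ℂ) + d) with hNd
  have hwim0 : (w : ℂ).im ≠ 0 := w.im_ne_zero
  have hWim : W.im ≠ 0 := by
    intro h0
    rw [h0, mul_zero] at key2
    exact hwim0 key2.symm
  rw [div_eq_div_iff hWim hwim0]
  calc (x 0 * Complex.normSq W + x 1 * W.re + x 2) * (w : ℂ).im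
      = (x 0 * Complex.normSq W + x 1 * W.re + x 2) * (Nd * W.im) := by rw [key2]
    _ = Nd * (x 0 * Complex.normSq W + x 1 * W.re + x 2) * W.im := by ring
    _ = _ := by rw [key]

/-- `q⁺_{g w}(x) = q⁺_w(x ∘ g)`. [folklore] -/
theorem majorant_glOf {a b c d : ℝ} (hdet : a * d - b * c = 1) (w : ℍ) (x : V) :
    majorant ((glOf a b c d hdet) • w) x = majorant w (actV a b c d x) := by
  rw [majorant, majorant, pw_glOf hdet, disc_actV, hdet, one_pow, one_mul]

/-- `(x ∘ g)(w, 1) = (c w + d)² x(g w, 1)`. [folklore] -/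
theorem formEval_glOf {a b c d : ℝ} (hdet : a * d - b * c = 1) (w : ℍ) (x : V) :
    formEval (actV a b c d x) w = ((c : ℂ) * w + d) ^ 2 * formEval x ((((glOf a b c d hdet) • w : ℍ) : ℂ)) := by
  rw [coe_glOf_smul hdet w]
  exact formEval_actV a b c d x (moeb_denom_ne_zero hdet w)

/-- **`f_{w,Z}(x ∘ g) = (c w + d)² f_{g w,Z}(x)`** for real `g` of determinant one.
[cite: Shintani1975, (2.12)] -/
theorem shintaniFn_glOf {a b c d : ℝ} (hdet : a * d - b * c = 1) (w Z : ℍ) (x : V) :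
    shintaniFn w Z (actV a b c d x) = ((c : ℂ) * w + d) ^ 2 * shintaniFn ((glOf a b c d hdet) • w) Z x := by
  unfold shintaniFn
  rw [formEval_glOf hdet, majorant_glOf hdet, disc_actV, hdet, one_pow, one_mul]
  ring

/-! ### Moving the two roots of an indefinite form to `∞` and `0` -/

/-- **An indefinite form is conjugate to `λ XY` over `ℝ`**: there is a real `g = (a b; c d)` of
determinant one and `λ ≠ 0` with `x ∘ g = λ XY` (moving the two roots to `∞` and `0`). [folklore] -/
theorem exists_conj_to_xyForm {x : V} (hdisc : 0 < disc x) :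
    ∃ (a b c d lam : ℝ), a * d - b * c = 1 ∧ lam ≠ 0 ∧ actV a b c d x = xyForm lam := by
  by_cases hx0 : x 0 = 0
  · -- one root is `∞`; translate the other to `0`
    have hx1 : x 1 ≠ 0 := by
      intro h1; rw [disc, hx0, h1] at hdisc; simp at hdisc
    refine ⟨1, -x 2 / x 1, 0, 1, x 1, by ring, hx1, ?_⟩
    ext i
    fin_cases i
    · simp [actV, xyForm, hx0]
    · simp [actV, xyForm, hx0]
    · simp [actV, xyForm, hx0]; field_simp; ring
  · -- roots `ξ₁ < ξ₂`: `g⁻¹ w = (w - ξ₂)/((ξ₂ - ξ₁)(w - ξ₁))`-type normalisation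
    set s : ℝ := Real.sqrt (disc x) with hs
    have hs2 : s ^ 2 = disc x := Real.sq_sqrt hdisc.le
    have hspos : 0 < s := Real.sqrt_pos.mpr hdisc
    -- the two roots
    set ξ₁ : ℝ := (-x 1 - s) / (2 * x 0) with hξ₁
    set ξ₂ : ℝ := (-x 1 + s) / (2 * x 0) with hξ₂
    have hd : disc x = x 1 ^ 2 - 4 * x 0 * x 2 := rfl
    have hroot : ∀ ξ : ℝ, (ξ = ξ₁ ∨ ξ = ξ₂) → x 0 * ξ ^ 2 + x 1 * ξ + x 2 = 0 := by
      intro ξ hξ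
      rcases hξ with rfl | rfl
      · rw [hξ₁]; field_simp; linear_combination hs2 + hd
      · rw [hξ₂]; field_simp; linear_combination hs2 + hd
    have hdiff : ξ₂ - ξ₁ = s / x 0 := by
      rw [hξ₁, hξ₂]; field_simp; ring
    have hdne : ξ₂ - ξ₁ ≠ 0 := by rw [hdiff]; exact div_ne_zero hspos.ne' hx0
    set δ : ℝ := ξ₂ - ξ₁ with hδ
    -- `g = (-ξ₁, ξ₂/δ; -1, 1/δ)` (so that `g⁻¹ = (1/δ, -ξ₂/δ; 1, -ξ₁)` sends `ξ₁ ↦ ∞`, `ξ₂ ↦ 0`)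
    refine ⟨-ξ₁, ξ₂ / δ, -1, 1 / δ, actV (-ξ₁) (ξ₂ / δ) (-1) (1 / δ) x 1, ?_, ?_, ?_⟩
    · field_simp; ring
    · -- `λ² = disc (x ∘ g) = disc x > 0`
      intro h0
      have hd := disc_actV (-ξ₁) (ξ₂ / δ) (-1) (1 / δ) x
      have hdet' : (-ξ₁) * (1 / δ) - ξ₂ / δ * (-1) = 1 := by field_simp; ring
      rw [hdet', one_pow, one_mul] at hd
      have h0' : actV (-ξ₁) (ξ₂ / δ) (-1) (1 / δ) x 0 = 0 := by
        rw [actV_zero]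
        have := hroot ξ₁ (Or.inl rfl)
        nlinarith [this]
      rw [disc, h0, h0'] at hd
      simp at hd
      linarith
    · have h0' : actV (-ξ₁) (ξ₂ / δ) (-1) (1 / δ) x 0 = 0 := by
        rw [actV_zero]
        have := hroot ξ₁ (Or.inl rfl)
        nlinarith [this]
      have h2' : actV (-ξ₁) (ξ₂ / δ) (-1) (1 / δ) x 2 = 0 := by
        rw [actV_two]
        have := hroot ξ₂ (Or.inr rfl)
        field_simp
        nlinarith [this]
      ext i
      fin_cases i
      · simpa [xyForm] using h0'
      · simp [xyForm]
      · simpa [xyForm] using h2'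

end Literature.NumberTheory.EllipticCurves.Shintani
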